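import Mathlib
import Literature.Analysis.FluidPDE.VectorCalculus
import Literature.Analysis.FluidPDE.LeiZhang2011Proofs

/-!
# Route `FilamentSkeletonRss` · crux `SelectionBoxRJ` (stmt-NavierStokesRegularity-21220) — rung tools:
# the `Γ`-uniform in-ball bending and curvature bounds of the forced local-induction model

Lane `ns-filament-19175-p1` (g6); the ODE leg of the memo `SIGMA-SCALING-21220.md` (item evidence #18, §2 and §5).
Helper file `--supports stmt-NavierStokesRegularity-21220`; route-independent (no `Theses` import).

In waist units the exactly tangent skeleton solves the forced local-induction equation `x″ = η x′ × (V(x) + U)`,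
`V y = ½ y − α e₃ × y`, `η ≈ 8π/(γ log Γ)`, with `U` the partner field plus the beyond-LIA remainder
(`…SelectionBoxRJRungSlipLaw`, `liaModel_tangency`).  Two elementary consequences, for a unit-speed solution and a
forcing bounded by `M` on the parameter window `|s| ≤ ℓ`:

* `norm_drift_le` — `‖V y‖ ≤ (½ + |α|) ‖y‖` (`‖e₃‖ = 1` is `simp`; cf. `Literature.Topology.FourManifolds.SweepDriver.norm_single_two`).
* `liaModel_curvature_bound` — `‖x″ s‖ ≤ |η| ((½ + |α|) ‖x s‖ + M)`: with `‖x s‖ ≤ Rb√(log Γ)` on the tangency ball the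
  waist-unit curvature is `≤ η((½+|α|) Rb √(log Γ) + M) = O(Rb/√(log Γ))`, so the box's curvature clause
  `‖X″‖√Γ ≤ K` holds in the ball for every fixed `K` once `Γ` is large (the model half of "witnesses bend, but only by
  `1/log Γ`", cf. `StraightSkeleton.straight_box_absurd`).
* `liaModel_position_bound` — `‖x s‖ ≤ ‖x 0‖ + |s|` (unit speed).
* `liaModel_bending_bound` — on `|s| ≤ ℓ`, `‖x′ s − x′ 0‖ ≤ |η| ((½ + |α|)(‖x 0‖ + ℓ) + M) |s|`.  In the box scaling
  (`ℓ = Rb√(log Γ)`, `η = 8π/(γ log Γ)`, `‖x 0‖ ≤ Rw`) the total in-ball bending angle is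
  `≤ (8π/γ)(½ + |α|) Rb² + O(1/√(log Γ))` — `Γ`-UNIFORM and `O(Rb²)`: the near-straightness hypothesis `θ` of the tail
  refinement `nearStraight_selfInductionTail` (`…RungNearStraightTail`) is met with `θ = O(Rb²)` for small `Rb`, for all `Γ`.

HONEST FRAMING.  Model-level (LIA with frozen forcing) bookkeeping for the rung ladder of a HYPOTHETICAL filament box;
nothing here is a claim about Navier–Stokes regularity or blow-up.
-/

set_option linter.dupNamespace false

noncomputable section

namespace Summit.NavierStokesRegularity.NavierStokesRegularity.Theorems

open Set Function Filter Real
open Literature.Analysis.FluidPDE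
open scoped InnerProductSpace Topology

namespace SelectionBoxRJRung

/-- **Drift bound** `‖½ y − α e₃ × y‖ ≤ (½ + |α|) ‖y‖`. [folklore] -/
theorem norm_drift_le (α : ℝ) (y : EuclideanSpace ℝ (Fin 3)) :
    ‖(1 / 2 : ℝ) • y - α • cross (EuclideanSpace.single 2 1) y‖ ≤ (1 / 2 + |α|) * ‖y‖ := by
  have hnorm : ‖(EuclideanSpace.single (2 : Fin 3) (1 : ℝ) : EuclideanSpace ℝ (Fin 3))‖ = 1 := by simp
  have hc : ‖cross (EuclideanSpace.single (2 : Fin 3) (1 : ℝ)) y‖ ≤ ‖y‖ := by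
    calc ‖cross (EuclideanSpace.single (2 : Fin 3) (1 : ℝ)) y‖
        ≤ ‖(EuclideanSpace.single (2 : Fin 3) (1 : ℝ) : EuclideanSpace ℝ (Fin 3))‖ * ‖y‖ :=
          norm_cross_le_norm_mul_norm _ _
      _ = ‖y‖ := by rw [hnorm, one_mul]
  calc ‖(1 / 2 : ℝ) • y - α • cross (EuclideanSpace.single 2 1) y‖
      ≤ ‖(1 / 2 : ℝ) • y‖ + ‖α • cross (EuclideanSpace.single 2 1) y‖ := norm_sub_le _ _
    _ = 1 / 2 * ‖y‖ + |α| * ‖cross (EuclideanSpace.single (2 : Fin 3) (1 : ℝ)) y‖ := by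
        rw [norm_smul, norm_smul, Real.norm_eq_abs, Real.norm_eq_abs, abs_of_pos (by norm_num : (0:ℝ) < 1 / 2)]
    _ ≤ 1 / 2 * ‖y‖ + |α| * ‖y‖ := by gcongr
    _ = (1 / 2 + |α|) * ‖y‖ := by ring

/-- **Curvature bound of the forced local-induction model.** For a unit tangent `a`, if `n = η • a × (V y + u)` with
`‖u‖ ≤ M` then `‖n‖ ≤ |η| ((½ + |α|) ‖y‖ + M)`. [folklore] -/
theorem liaModel_curvature_bound (η α M : ℝ) (a y u n : EuclideanSpace ℝ (Fin 3)) (ha : ‖a‖ = 1) (hu : ‖u‖ ≤ M)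
    (hn : n = η • cross a ((1 / 2 : ℝ) • y - α • cross (EuclideanSpace.single 2 1) y + u)) :
    ‖n‖ ≤ |η| * ((1 / 2 + |α|) * ‖y‖ + M) := by
  rw [hn, norm_smul, Real.norm_eq_abs]
  refine mul_le_mul_of_nonneg_left ?_ (abs_nonneg η)
  calc ‖cross a ((1 / 2 : ℝ) • y - α • cross (EuclideanSpace.single 2 1) y + u)‖
      ≤ ‖a‖ * ‖(1 / 2 : ℝ) • y - α • cross (EuclideanSpace.single 2 1) y + u‖ := norm_cross_le_norm_mul_norm _ _
    _ = ‖(1 / 2 : ℝ) • y - α • cross (EuclideanSpace.single 2 1) y + u‖ := by rw [ha, one_mul]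
    _ ≤ ‖(1 / 2 : ℝ) • y - α • cross (EuclideanSpace.single 2 1) y‖ + ‖u‖ := norm_add_le _ _
    _ ≤ (1 / 2 + |α|) * ‖y‖ + M := add_le_add (norm_drift_le α y) hu

/-- **Position bound** along a unit-speed `C¹` curve: `‖x s‖ ≤ ‖x 0‖ + |s|`. [folklore] -/
theorem liaModel_position_bound {x : ℝ → EuclideanSpace ℝ (Fin 3)} (hx : Differentiable ℝ x)
    (hunit : ∀ t, ‖deriv x t‖ = 1) (s : ℝ) : ‖x s‖ ≤ ‖x 0‖ + |s| := by
  have h := Convex.norm_image_sub_le_of_norm_deriv_le (f := x) (fun v _ => hx v) (fun v _ => (hunit v).le)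
    convex_univ (mem_univ 0) (mem_univ s)
  rw [one_mul, sub_zero, Real.norm_eq_abs] at h
  calc ‖x s‖ = ‖x 0 + (x s - x 0)‖ := by rw [add_sub_cancel]
    _ ≤ ‖x 0‖ + ‖x s - x 0‖ := norm_add_le _ _
    _ ≤ ‖x 0‖ + |s| := by linarith

/-- **`Γ`-uniform in-ball bending bound of the forced local-induction model.** Let `x` be a `C²` unit-speed solution
of `x″ = η x′ × (V(x) + U)` (`V y = ½ y − α e₃ × y`) with `‖U s‖ ≤ M` on the window `|s| ≤ ℓ`.  Then for `|s| ≤ ℓ`,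
`‖x′ s − x′ 0‖ ≤ |η| ((½ + |α|)(‖x 0‖ + ℓ) + M) |s|` (mean value inequality on `[−ℓ, ℓ]` with the curvature bound).
With `ℓ = Rb√(log Γ)`, `η = 8π/(γ log Γ)` the right-hand side at `|s| = ℓ` is `(8π/γ)((½+|α|)Rb² + O(1/√log Γ))`.
[folklore] -/
theorem liaModel_bending_bound {η α M ℓ : ℝ} {U x : ℝ → EuclideanSpace ℝ (Fin 3)}
    (hx : ContDiff ℝ 2 x) (hunit : ∀ t, ‖deriv x t‖ = 1)
    (hode : ∀ t, iteratedDeriv 2 x t = η • cross (deriv x t)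
      ((1 / 2 : ℝ) • x t - α • cross (EuclideanSpace.single 2 1) (x t) + U t))
    (hU : ∀ t, |t| ≤ ℓ → ‖U t‖ ≤ M) {s : ℝ} (hs : |s| ≤ ℓ) :
    ‖deriv x s - deriv x 0‖ ≤ |η| * ((1 / 2 + |α|) * (‖x 0‖ + ℓ) + M) * |s| := by
  have hxd : Differentiable ℝ x := hx.differentiable (by norm_num)
  have hTd : Differentiable ℝ (deriv x) := hx.differentiable_deriv_two
  have h2 : iteratedDeriv 2 x = deriv (deriv x) := by
    rw [iteratedDeriv_succ, iteratedDeriv_one]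
  have hℓ : 0 ≤ ℓ := (abs_nonneg s).trans hs
  -- curvature bound on the window
  have hcurv : ∀ t ∈ Icc (-ℓ) ℓ, ‖deriv (deriv x) t‖ ≤ |η| * ((1 / 2 + |α|) * (‖x 0‖ + ℓ) + M) := by
    intro t ht
    have htℓ : |t| ≤ ℓ := abs_le.2 ⟨ht.1, ht.2⟩
    have hn : deriv (deriv x) t = η • cross (deriv x t)
        ((1 / 2 : ℝ) • x t - α • cross (EuclideanSpace.single 2 1) (x t) + U t) := by
      rw [← h2, hode t]
    have h1 := liaModel_curvature_bound η α M (deriv x t) (x t) (U t) (deriv (deriv x) t) (hunit t) (hU t htℓ) hn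
    have hpos : ‖x t‖ ≤ ‖x 0‖ + ℓ := (liaModel_position_bound hxd hunit t).trans (by linarith)
    calc ‖deriv (deriv x) t‖ ≤ |η| * ((1 / 2 + |α|) * ‖x t‖ + M) := h1
      _ ≤ |η| * ((1 / 2 + |α|) * (‖x 0‖ + ℓ) + M) := by
          gcongr
  -- mean value inequality for `deriv x` on the segment
  have hsI : s ∈ Icc (-ℓ) ℓ := ⟨(abs_le.1 hs).1, (abs_le.1 hs).2⟩
  have h0I : (0 : ℝ) ∈ Icc (-ℓ) ℓ := ⟨by linarith, hℓ⟩
  have h := Convex.norm_image_sub_le_of_norm_deriv_le (f := deriv x) (fun v _ => hTd v) hcurv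
    (convex_Icc (-ℓ) ℓ) h0I hsI
  rw [sub_zero, Real.norm_eq_abs] at h
  exact h

/-- **Bending below a prescribed angle.** Under the hypotheses of `liaModel_bending_bound`, if
`|η| ((½ + |α|)(‖x 0‖ + ℓ) + M) ℓ ≤ θ` then the tangent stays within `θ` of its waist value on the whole window:
`‖x′ s − x′ 0‖ ≤ θ` for `|s| ≤ ℓ` — the near-straightness hypothesis of `nearStraight_selfInductionTail` with
`a = x′ 0`. [folklore] -/
theorem liaModel_nearStraight {η α M ℓ θ : ℝ} {U x : ℝ → EuclideanSpace ℝ (Fin 3)}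
    (hx : ContDiff ℝ 2 x) (hunit : ∀ t, ‖deriv x t‖ = 1)
    (hode : ∀ t, iteratedDeriv 2 x t = η • cross (deriv x t)
      ((1 / 2 : ℝ) • x t - α • cross (EuclideanSpace.single 2 1) (x t) + U t))
    (hM : 0 ≤ M) (hU : ∀ t, |t| ≤ ℓ → ‖U t‖ ≤ M)
    (hθ : |η| * ((1 / 2 + |α|) * (‖x 0‖ + ℓ) + M) * ℓ ≤ θ) {s : ℝ} (hs : |s| ≤ ℓ) :
    ‖deriv x s - deriv x 0‖ ≤ θ := by
  have h := liaModel_bending_bound hx hunit hode hU hs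
  have hK : 0 ≤ |η| * ((1 / 2 + |α|) * (‖x 0‖ + ℓ) + M) := by
    have hℓ : 0 ≤ ℓ := (abs_nonneg s).trans hs
    positivity
  calc ‖deriv x s - deriv x 0‖ ≤ |η| * ((1 / 2 + |α|) * (‖x 0‖ + ℓ) + M) * |s| := h
    _ ≤ |η| * ((1 / 2 + |α|) * (‖x 0‖ + ℓ) + M) * ℓ := mul_le_mul_of_nonneg_left hs hK
    _ ≤ θ := hθ

end SelectionBoxRJRung

end Summit.NavierStokesRegularity.NavierStokesRegularity.Theorems
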